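import Summits.BirchSwinnertonDyer.BirchSwinnertonDyer.Theorems.KimAtThreeDeepLowerOffStratumLevelLoweringStabEigenform
import Summits.BirchSwinnertonDyer.BirchSwinnertonDyer.Theorems.ResidualThetaTransportAtTwoThetaLayerLambdaCongruenceAtTwoDepletionMonotone
import Literature.NumberTheory.EllipticCurves.ModularityVersionApProofs
import Literature.NumberTheory.EllipticCurves.HasseWeilAbelianBadReduction
import Literature.NumberTheory.EllipticCurves.RootNumberAtkinLehnerSemistableProofs
import Literature.NumberTheory.DiophantineGeometry.LocalReduction
import Literature.NumberTheory.EllipticCurves.NewformsCoeffFieldHolds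
import Literature.NumberTheory.EllipticCurves.ManinConstantClassCertificateTwist
import Literature.NumberTheory.Automorphic.HilbertPartialHasseWeightShiftingProofs
import Mathlib.NumberTheory.Padics.Complex
import HarnessLib

/-!
# Route `SignedLowerHalves`, crux L `SmallImageLowerHalfBothSigns` (item stmt-BirchSwinnertonDyer-23599), line `rtt_w3`,
# stub Kan₂ `stub_thetaLayerLambda_ns` — brick K3/K6′: bridges for Vatsal's hypotheses — the curve's Euler polynomials
# as Hecke polynomials, number-field / integrality bookkeeping, and the ALL-`n` congruence from the prime congruence

Width seat `bsd-line-slh-p3-w3` g11 under LEAD `cruxlead-stmt-BirchSwinnertonDyer-23599` g0 (cell `bsd-ssimc`). ROUTE-INDEPENDENT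
helper (`--supports stmt-BirchSwinnertonDyer-23599`); THEOREMS ONLY — no definition, no named fact, no `sorry`; closes nothing;
BSD is not proved by any of this.

* §1 `norm_symm_cuspCoeff_le_one_of_isNewform0` (newform coefficients are algebraic integers: `‖e⁻¹ aₙ‖ ≤ 1` for `e : ℚ̄_p ≃ ℂ`;
  the `Valued.v` forms are the tree's `GL1Cartan.Exc.valuation_le_one_iff` / `valuation_cuspCoeff_le_one_of_isNewform0`).
* §2 `map_localPolynomialAt_eq'` — `L_v(W, X) = 1 − a_ℓ(W)X + 𝟙_{ℓ∤N_W} ℓ X²` in `ℚ̄_p[X]` (port of the tree's `p = 2`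
  `ThetaLayerLambdaCongruenceAtTwo.map_localPolynomialAt_eq`); `four_le_conductorNorm_of_not_semistable`.
* §3 `finiteDimensional_coeffField_of_cuspCoeff` — a form whose coefficients are `0` or coefficients of `g` has coefficient field
  inside `K_g` (a number field when `K_g` is).
* §4 ★ `norm_symm_cuspCoeff_sub_lt_one_of_coprime` — two normalised NEWFORMS `f, g` (levels `N`, `M`) congruent at every prime
  `q ∤ NM` are congruent at every `n` coprime to `NM` (coprime multiplicativity `IsNewform0.coeff_mul_of_coprime` + the Hecke
  recursion at prime powers + integrality; ultrametric estimates).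

References: [DiamondShurman2005] Prop. 5.8.5, §8.3; [SilvermanAEC2009] §C.16; [Shimura1971] Thm. 3.48; [Vatsal1999] (1.1).
-/

set_option autoImplicit false
-- D-0017: single-problem summit, the namespace repeats the problem name by design.
set_option linter.dupNamespace false

noncomputable section

open scoped MatrixGroups ModularForm Classical NNReal

open CongruenceSubgroup Literature.NumberTheory.EllipticCurves Literature.NumberTheory.EllipticCurves.ModularForms Polynomial
  IsDedekindDomain NumberField
open UpperHalfPlane hiding I

namespace Summit.BirchSwinnertonDyer.BirchSwinnertonDyer.Theorems.SmallImageRttKan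

open Summit.BirchSwinnertonDyer.BirchSwinnertonDyer.Theorems.KimAtThreeDeepLowerOffStratumLevelLoweringStabEigenform
  (cuspCoeff_mul_cuspCoeff)
open Summit.BirchSwinnertonDyer.BirchSwinnertonDyer.Theorems.ThetaLayerLambdaCongruenceAtTwo (localPolynomialAt_eq_of_good)

/-! ### §1 Valuations and integrality in `ℚ̄_p` -/

section Valuation

variable {p : ℕ} [Fact p.Prime]

/-- The coefficients of a newform are `p`-adically integral through any `e : ℚ̄_p ≃ ℂ` (they are algebraic integers,
`IsNewform0.isIntegral_coeff_holds`). [cite: Shimura1971, Thm. 3.48] -/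
theorem norm_symm_cuspCoeff_le_one_of_isNewform0 {M : ℕ} [NeZero M] {g : CuspForm (Gamma0 M) 2} (hg : IsNewform0 g)
    (e : PadicAlgCl p ≃+* ℂ) (n : ℕ) : ‖e.symm (cuspCoeff g n)‖ ≤ 1 :=
  Literature.NumberTheory.Automorphic.PadicAlgCl.norm_le_one_of_isIntegral p
    ((IsNewform0.isIntegral_coeff_holds hg n).map (e.symm : ℂ →+* PadicAlgCl p).toIntAlgHom)

end Valuation

/-! ### §2 The curve's Euler polynomials and its conductor -/

section Euler

variable (W : WeierstrassCurve ℚ) [W.IsElliptic] [W.IsGloballyMinimal] {p : ℕ} [Fact p.Prime]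

/-- **`L_v(W, X) = 1 − a_ℓ(W)·X + 𝟙_{ℓ∤N_W}·ℓ·X²` in `ℚ̄_p[X]`** for every finite place `v` of `ℚ` (`ℓ = ℓ_v`,
`a_ℓ(W) = W.LFunction ℓ`): the reduction trichotomy at `v` (port of the tree's `p = 2` `map_localPolynomialAt_eq`).
[cite: SilvermanAEC2009, §C.16 (definition of L_v(T)) and Exercise 8.19(a)] -/
theorem map_localPolynomialAt_eq' (v : HeightOneSpectrum (𝓞 ℚ)) :
    (W.localPolynomialAt v).map (Int.castRingHom (PadicAlgCl p)) =
      1 - C ((W.LFunction (Rat.HeightOneSpectrum.natGenerator v) : PadicAlgCl p)) * X +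
        (if Rat.HeightOneSpectrum.natGenerator v ∣ W.conductorNorm ℤ then 0
          else C (Rat.HeightOneSpectrum.natGenerator v : PadicAlgCl p)) * X ^ 2 := by
  haveI : Fact (Rat.HeightOneSpectrum.natGenerator v).Prime := ⟨Rat.HeightOneSpectrum.prime_natGenerator v⟩
  have hpe : ((Rat.HeightOneSpectrum.primesEquiv v : Nat.Primes) : ℕ) = Rat.HeightOneSpectrum.natGenerator v := rfl
  rcases WeierstrassCurve.hasGoodReductionAt_or_hasMultiplicativeReductionAt_or_hasAdditiveReductionAt v W with
      hgood | hmul | hadd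
  · have hndvd : ¬ Rat.HeightOneSpectrum.natGenerator v ∣ W.conductorNorm ℤ :=
      fun h ↦ (WeierstrassCurve.dvd_conductorNorm_iff W v).mp h hgood
    have ha : W.LFunction (Rat.HeightOneSpectrum.natGenerator v) = W.frobeniusTrace (Rat.HeightOneSpectrum.natGenerator v) :=
      WeierstrassCurve.LFunction_apply_prime_eq_frobeniusTrace W _
        ((WeierstrassCurve.hasGoodReductionAtPrime_iff_hasGoodReductionAt_ringOfIntegers v W).mpr hgood)
    rw [localPolynomialAt_eq_of_good hgood, if_neg hndvd, ha]
    simp only [Polynomial.map_add, Polynomial.map_sub, Polynomial.map_mul, Polynomial.map_pow, Polynomial.map_one,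
      Polynomial.map_X, Polynomial.map_C]
    simp only [eq_intCast, Int.cast_natCast]
  · have hdvd : Rat.HeightOneSpectrum.natGenerator v ∣ W.conductorNorm ℤ :=
      (WeierstrassCurve.dvd_conductorNorm_iff W v).mpr hmul.not_hasGoodReductionAt
    rw [if_pos hdvd, zero_mul, add_zero]
    by_cases hsplit : W.HasSplitMultiplicativeReductionAt v
    · rw [WeierstrassCurve.localPolynomialAt_of_hasSplitMultiplicativeReductionAt hsplit,
        ← hpe, W.LFunction_apply_primesEquiv_of_hasSplitMultiplicativeReductionAt hsplit]
      simp
    · rw [WeierstrassCurve.localPolynomialAt_of_hasMultiplicativeReductionAt_of_not_hasSplitMultiplicativeReductionAt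
        hmul hsplit, ← hpe, W.LFunction_apply_primesEquiv_of_hasMultiplicativeReductionAt_of_not_split hmul hsplit]
      simp
  · have hdvd : Rat.HeightOneSpectrum.natGenerator v ∣ W.conductorNorm ℤ :=
      (WeierstrassCurve.dvd_conductorNorm_iff W v).mpr hadd.not_hasGoodReductionAt
    rw [if_pos hdvd, zero_mul, add_zero, WeierstrassCurve.localPolynomialAt_of_hasAdditiveReductionAt hadd, ← hpe,
      W.LFunction_apply_primesEquiv_of_hasAdditiveReductionAt hadd]
    simp

omit [W.IsGloballyMinimal] [Fact p.Prime] in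
/-- A non-semistable elliptic curve has an additive prime `q`, so `q² ∣ N_W` and `4 ≤ N_W` (Vatsal's standing `M ≥ 4`).
[cite: Silverman1994, IV.10.2(c)] -/
theorem four_le_conductorNorm_of_not_semistable [NeZero (W.conductorNorm ℤ)] (h : ¬ Rank1Residual.Semistable W) :
    4 ≤ W.conductorNorm ℤ := by
  unfold Rank1Residual.Semistable at h
  push Not at h
  obtain ⟨q, hq, hgood, hmult⟩ := h
  haveI : Fact q.Prime := ⟨hq⟩
  have hsq : q ^ 2 ∣ W.conductorNorm ℤ := sq_dvd_conductorNorm_of_not_good_of_not_mult ⟨hgood, hmult⟩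
  have hN0 : W.conductorNorm ℤ ≠ 0 := NeZero.ne _
  have h4 : 4 ≤ q ^ 2 := by nlinarith [hq.two_le]
  exact h4.trans (Nat.le_of_dvd (Nat.pos_of_ne_zero hN0) hsq)

end Euler

/-! ### §3 The coefficient field of a form with coefficients among those of `g` -/

section CoeffField

variable {N M : ℕ} {G : CuspForm (Gamma0 N) 2} {g : CuspForm (Gamma0 M) 2}

/-- If every coefficient of `G` is `0` or the corresponding coefficient of `g`, then `K_G ≤ K_g`; in particular `K_G` is a
number field when `K_g` is. [folklore] -/
theorem finiteDimensional_coeffField_of_cuspCoeff (hfd : FiniteDimensional ℚ (coeffField g))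
    (h : ∀ n : ℕ, cuspCoeff G n = 0 ∨ cuspCoeff G n = cuspCoeff g n) :
    FiniteDimensional ℚ (coeffField G) := by
  have hle : coeffField G ≤ coeffField g := by
    rw [coeffField, IntermediateField.adjoin_le_iff]
    rintro _ ⟨n, rfl⟩
    show cuspCoeff G n ∈ coeffField g
    rcases h n with h0 | h1
    · rw [h0]; exact zero_mem _
    · rw [h1]; exact coeff_mem_coeffField g n
  haveI := hfd
  exact FiniteDimensional.of_injective (IntermediateField.inclusion hle).toLinearMap
    (IntermediateField.inclusion_injective hle)

end CoeffField

/-! ### §4 Congruent newforms are congruent at every index prime to the levels -/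

section Congruence

variable {p : ℕ} [Fact p.Prime] {N M : ℕ} [NeZero N] [NeZero M]
  {f : CuspForm (Gamma0 N) 2} {g : CuspForm (Gamma0 M) 2}

omit [NeZero N] [NeZero M] in
/-- Ultrametric product estimate: `‖x‖,‖y'‖ ≤ 1`, `‖x − x'‖ < 1`, `‖y − y'‖ < 1 ⟹ ‖xy − x'y'‖ < 1`. [folklore] -/
theorem norm_mul_sub_mul_lt_one {x x' y y' : PadicAlgCl p} (hx : ‖x‖ ≤ 1) (hy' : ‖y'‖ ≤ 1)
    (hxx : ‖x - x'‖ < 1) (hyy : ‖y - y'‖ < 1) : ‖x * y - x' * y'‖ < 1 := by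
  have e : x * y - x' * y' = x * (y - y') + (x - x') * y' := by ring
  rw [e]
  refine lt_of_le_of_lt (IsUltrametricDist.norm_add_le_max _ _) (max_lt ?_ ?_)
  · rw [norm_mul]
    calc ‖x‖ * ‖y - y'‖ ≤ 1 * ‖y - y'‖ := by gcongr
      _ < 1 := by rw [one_mul]; exact hyy
  · rw [norm_mul]
    calc ‖x - x'‖ * ‖y'‖ ≤ ‖x - x'‖ * 1 := by gcongr
      _ < 1 := by rw [mul_one]; exact hxx

/-- ★ **Congruent newforms are congruent at every index prime to the levels.** Let `f ∈ S₂(Γ₀(N))`, `g ∈ S₂(Γ₀(M))` be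
newforms and `e : ℚ̄_p ≃ ℂ`; if `‖e⁻¹(a_q(f) − a_q(g))‖ < 1` for every prime `q ∤ NM` then `‖e⁻¹(aₙ(f) − aₙ(g))‖ < 1` for every
`n` coprime to `NM` (coprime multiplicativity, the Hecke recursion `a_{q^{k+2}} = a_q a_{q^{k+1}} − q a_{q^k}` for `q ∤ NM`, and
integrality of the coefficients). [cite: DiamondShurman2005, Prop. 5.8.5] [cite: Vatsal1999, (1.1)] -/
theorem norm_symm_cuspCoeff_sub_lt_one_of_coprime (hf : IsNewform0 f) (hg : IsNewform0 g) (e : PadicAlgCl p ≃+* ℂ)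
    (hq : ∀ q : ℕ, q.Prime → ¬ q ∣ N * M → ‖e.symm (cuspCoeff f q) - e.symm (cuspCoeff g q)‖ < 1) :
    ∀ n : ℕ, n.Coprime (N * M) → ‖e.symm (cuspCoeff f n) - e.symm (cuspCoeff g n)‖ < 1 := by
  have hfi : ∀ n, ‖e.symm (cuspCoeff f n)‖ ≤ 1 := norm_symm_cuspCoeff_le_one_of_isNewform0 hf e
  have hgi : ∀ n, ‖e.symm (cuspCoeff g n)‖ ≤ 1 := norm_symm_cuspCoeff_le_one_of_isNewform0 hg e
  -- prime powers
  have hpow : ∀ q : ℕ, q.Prime → ¬ q ∣ N * M → ∀ k : ℕ,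
      ‖e.symm (cuspCoeff f (q ^ k)) - e.symm (cuspCoeff g (q ^ k))‖ < 1 := by
    intro q hq' hqNM k
    have hqN : ¬ q ∣ N := fun h ↦ hqNM (h.mul_right M)
    have hqM : ¬ q ∣ M := fun h ↦ hqNM (h.mul_left N)
    induction k using Nat.strong_induction_on with
    | _ k ih =>
      match k with
      | 0 =>
        rw [pow_zero, show cuspCoeff f 1 = 1 from hf.2.2, show cuspCoeff g 1 = 1 from hg.2.2, sub_self, norm_zero]
        exact one_pos
      | 1 => rw [pow_one]; exact hq q hq' hqNM
      | k + 2 =>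
        -- `a_{q^{k+2}} = a_q a_{q^{k+1}} − q a_{q^k}` for both forms
        have hdiv : q ^ (k + 1) / q = q ^ k := by rw [pow_succ, Nat.mul_div_cancel _ hq'.pos]
        have Rf := cuspCoeff_mul_cuspCoeff hf.2.1 hf.2.2 hq' (q ^ (k + 1))
        have Rg := cuspCoeff_mul_cuspCoeff hg.2.1 hg.2.2 hq' (q ^ (k + 1))
        rw [if_neg hqN, if_pos (dvd_pow_self q (Nat.succ_ne_zero k)), hdiv, ← pow_succ'] at Rf
        rw [if_neg hqM, if_pos (dvd_pow_self q (Nat.succ_ne_zero k)), hdiv, ← pow_succ'] at Rg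
        have ef : cuspCoeff f (q ^ (k + 2)) = cuspCoeff f q * cuspCoeff f (q ^ (k + 1)) - q * cuspCoeff f (q ^ k) := by
          linear_combination -Rf
        have eg : cuspCoeff g (q ^ (k + 2)) = cuspCoeff g q * cuspCoeff g (q ^ (k + 1)) - q * cuspCoeff g (q ^ k) := by
          linear_combination -Rg
        rw [ef, eg, map_sub, map_sub, map_mul, map_mul, map_mul, map_mul, map_natCast]
        have e1 : e.symm (cuspCoeff f q) * e.symm (cuspCoeff f (q ^ (k + 1))) - (q : PadicAlgCl p) * e.symm (cuspCoeff f (q ^ k)) -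
            (e.symm (cuspCoeff g q) * e.symm (cuspCoeff g (q ^ (k + 1))) - (q : PadicAlgCl p) * e.symm (cuspCoeff g (q ^ k))) =
            (e.symm (cuspCoeff f q) * e.symm (cuspCoeff f (q ^ (k + 1))) -
              e.symm (cuspCoeff g q) * e.symm (cuspCoeff g (q ^ (k + 1)))) +
            -((q : PadicAlgCl p) * (e.symm (cuspCoeff f (q ^ k)) - e.symm (cuspCoeff g (q ^ k)))) := by ring
        rw [e1]
        refine lt_of_le_of_lt (IsUltrametricDist.norm_add_le_max _ _) (max_lt ?_ ?_)
        · have h1 := ih 1 (by omega)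
          rw [pow_one] at h1
          exact norm_mul_sub_mul_lt_one (hfi q) (hgi _) h1 (ih (k + 1) (by omega))
        · rw [norm_neg, norm_mul]
          have hqn : ‖(q : PadicAlgCl p)‖ ≤ 1 := by
            have := Literature.NumberTheory.Automorphic.PadicAlgCl.norm_le_one_of_isIntegral p
              (isIntegral_algebraMap (R := ℤ) (A := PadicAlgCl p) (x := (q : ℤ)))
            simpa using this
          calc ‖(q : PadicAlgCl p)‖ * ‖e.symm (cuspCoeff f (q ^ k)) - e.symm (cuspCoeff g (q ^ k))‖
              ≤ 1 * ‖e.symm (cuspCoeff f (q ^ k)) - e.symm (cuspCoeff g (q ^ k))‖ := by gcongr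
            _ < 1 := by rw [one_mul]; exact ih k (by omega)
  -- general `n` by strong induction
  intro n
  induction n using Nat.strong_induction_on with
  | _ n ih =>
    intro hn
    rcases Nat.lt_or_ge n 2 with hlt | hge
    · interval_cases n
      · rw [cuspCoeff_zero (one_mem_strictPeriods_gamma0 N) f, cuspCoeff_zero (one_mem_strictPeriods_gamma0 M) g, sub_self,
          norm_zero]; exact one_pos
      · rw [show cuspCoeff f 1 = 1 from hf.2.2, show cuspCoeff g 1 = 1 from hg.2.2, sub_self, norm_zero]; exact one_pos
    · have hn0 : n ≠ 0 := by omega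
      set q := n.minFac with hqdef
      have hq' : q.Prime := Nat.minFac_prime (by omega)
      have hqn : q ∣ n := Nat.minFac_dvd n
      obtain ⟨k, m, hqm, hnm⟩ := Nat.exists_eq_pow_mul_and_not_dvd hn0 q hq'.ne_one
      have hqNM : ¬ q ∣ N * M := fun h ↦ by
        have := Nat.Coprime.coprime_dvd_left hqn hn
        exact hq'.ne_one ((Nat.coprime_self q).mp (this.coprime_dvd_right h))
      have hk : 1 ≤ k := by
        by_contra h0
        have : k = 0 := by omega
        rw [this, pow_zero, one_mul] at hnm
        exact hqm (hnm ▸ hqn)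
      have hm0 : m ≠ 0 := by rintro rfl; rw [mul_zero] at hnm; exact hn0 hnm
      have hmlt : m < n := by
        rw [hnm]
        have : 1 < q ^ k := Nat.one_lt_pow (by omega) hq'.one_lt
        exact lt_mul_left (Nat.pos_of_ne_zero hm0) this
      have hcop : (q ^ k).Coprime m := (Nat.Coprime.pow_left k ((Nat.Prime.coprime_iff_not_dvd hq').mpr hqm))
      have hmNM : m.Coprime (N * M) := Nat.Coprime.coprime_dvd_left (Dvd.intro_left _ hnm.symm) hn
      rw [hnm, show cuspCoeff f (q ^ k * m) = cuspCoeff f (q ^ k) * cuspCoeff f m from IsNewform0.coeff_mul_of_coprime_holds hf hcop,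
        show cuspCoeff g (q ^ k * m) = cuspCoeff g (q ^ k) * cuspCoeff g m from IsNewform0.coeff_mul_of_coprime_holds hg hcop,
        map_mul, map_mul]
      exact norm_mul_sub_mul_lt_one (hfi _) (hgi _) (hpow q hq' hqNM k) (ih m hmlt hmNM)

end Congruence

end Summit.BirchSwinnertonDyer.BirchSwinnertonDyer.Theorems.SmallImageRttKan

end
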